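import Summits.QuantumFields.YangMills.Theorems.UniversalDetectorHankelCeiling
import Summits.QuantumFields.YangMills.Theorems.UniversalDetectorHankelLongitudinal
import Summits.QuantumFields.YangMills.Theorems.UniversalDetectorHankelTightGlue
import Summits.QuantumFields.YangMills.Theorems.UniversalDetectorCurvatureEdgeGlue
import Summits.QuantumFields.YangMills.Theorems.UniversalDetectorBitOfPlaneTight
import Summits.QuantumFields.YangMills.Theorems.UniversalDetectorDetectorExists
import Summits.QuantumFields.YangMills.Theorems.UniversalDetectorBlindRigidity
import Summits.QuantumFields.YangMills.Theorems.UniversalDetectorBlindSeqExtraction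
import HarnessLib

/-!
# Crux `BalabanLadder.NT` (stmt-QuantumFields-19353) — LINE «blind detector» (ym-idea-8 g11-1), birth skeleton

Filed on route `route-QuantumFields-UniversalDetector` (rev 8, commit b9ab1dc238a2; re-glued at rev 10, commit 6eac74774114,
so that `closes` takes the weakest entry directly).  The line decides `NT` from FOUR named obligations, TWO of them still stubs at rev 4 — exactly the route's two open CRUXES
(`stub_blindDetectorRigidity` is the landed `Cruxes.BlindDetectorRigidity.blindDetectorRigidity`, ✓p705845 by ym-line-sfw-p2-w4; `stub_blindSeqExtraction`
is the landed `Cruxes.UniversalDetectorBlindExtraction.blindSeqExtraction`, ✓p707587 by ★ ym-spine-19353-p1 g26; so item 24148 `BlindDetector` is proved —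
Theorems-side `Cruxes.UniversalDetectorBlindDetector.blindDetector_of_blindSeqExtraction` ✓p707667 applied to the extraction): the deciding crux
`SchemeEdgeBit` (stmt-QuantumFields-24146 — the stronger entries `SchemeCurvatureLaws` 24087 ⇒ `SchemeEdgeLaws` 23999 ⇒
`PlaneTightScheme` 23250 ⇒ 24146 are the LANDED chain `Theorems/UniversalDetectorSchemeEdgeBitOfEntries.lean`), the residual crux
`SkewAtEdgeScheme` (stmt-QuantumFields-24149, clause (ii) of `LowerBounds` re-pinned to EDGE ∧ NONCONTACT_Ω) — the support
`BitOfPlaneTight` (stmt-QuantumFields-24147) is PROVED (`universalDetector_bitOfPlaneTight_proof`, seat w4) — and the two analysis stubs of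
the support `BlindDetector` (stmt-QuantumFields-24148): `BlindSeqExtraction` (compactness PER ORTHANT of
`Ω = {all z_i ≠ 0}`, stated sequentially) and `BlindDetectorRigidity` (OS/Laplace rigidity blind to null sets: measurable
`K`, continuous on `Ω`, no permutation symmetry).  The composition `blindDetector_of` (the route header's contradiction run
on `Ω`, with the landed detector `universalDetector_detectorExists`) is kernel-checked here WITHOUT sorry; `NT_of` feeds the
route's `closes` (rev 10) with the landed proofs `universalDetector_hankelCeiling`, `universalDetector_hankelLongitudinal` cited BY
NAME (`NT_of_schemeCurvatureLaws` enters from the g10-3 crux through the landed chain).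
LEVER: the OS/Laplace dual differentiates only TIME and coordinate hyperplanes are Lebesgue-null for Schwartz pairings, the
RP inequality and Gaussian/Laplace deconvolution — so no transverse modulus (TRANS 23999 / CURV 24087) and no permutation
covariance is needed for clause (i); inside one orthant every axis is longitudinal, so the PROVED `HankelLongitudinal` is a
full modulus there.  No summit, rung or crux is proved by this file; NOT registered with `skeleton check` (the fleet's v4T
registry on 19353 stays the record).
-/

set_option autoImplicit false

namespace Summit.QuantumFields.YangMills.Cruxes.NT.BlindDetector

open Summit.QuantumFields.YangMills.Theses.UniversalDetector
open MeasureTheory Literature.MathematicalPhysics.QuantumFieldTheory Literature.MathematicalPhysics.QuantumLattice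
  Literature.Probability.LatticeModels Summit.QuantumFields.YangMills.Cruxes.OSLegsFromFemtoAndGap.DlrCollarTransfer

/-- STUB 1 of `BlindDetector` (blind SEQUENTIAL limit extraction on `Ω`; XL) — an obligation of LINE g11-1,
believed true (Arzelà–Ascoli per orthant of `Ω_η`, exact evenness, time-longitudinal `ϑ`/RP defects, `Q2` limit
with `O(τ)` slab mass). -/
def BlindSeqExtraction : Prop :=
  open MeasureTheory Literature.MathematicalPhysics.QuantumFieldTheory Literature.MathematicalPhysics.QuantumLattice Literature.Probability.LatticeModels Summit.QuantumFields.YangMills.Cruxes.OSLegsFromFemtoAndGap.DlrCollarTransfer in ∀ (G : Type) [Group G] [TopologicalSpace G] [IsTopologicalGroup G] [CompactSpace G], IsCompactSimpleLieGroup G → letI : MeasurableSpace G := borel G; haveI : BorelSpace G := ⟨rfl⟩; ∀ (r : LatticeRep G) (a : ℝ → ℝ), (∀ β, 0 < a β) → Filter.Tendsto a Filter.atTop (nhds 0) → let ker : ℝ → ℕ → (Fin 4 → ℤ) → ℝ := (fun (β : ℝ) (L : ℕ) (z : Fin 4 → ℤ) => (a β)⁻¹ ^ 8 * (torusE G r β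 L (fun U => dens G r 0 U * dens G r z U) - torusE G r β L (dens G r 0) * torusE G r β L (dens G r z))); let ker6 : ℝ → ℕ → Fin 4 × Fin 4 → Fin 4 × Fin 4 → (Fin 4 → ℤ) → ℝ := (fun (β : ℝ) (L : ℕ) (p q : Fin 4 × Fin 4) (z : Fin 4 → ℤ) => (a β)⁻¹ ^ 8 * (torusE G r β L (fun U => plane G r p 0 U * plane G r q z U) - torusE G r β L (plane G r p 0) * torusE G r β L (plane G r q z))); ∀ (βs : ℕ → ℝ) (Ls : ℕ → ℕ), Filter.Tendsto βs Filter.atTop Filter.atTop → Filter.Tendsto (fun k => a (βs k) * Ls k) Filter.atTop Filter.atTop → (∀ p q : Fin 4 × Fin 4, p.1 < p.2 → q.1 < q.2 → ∀ η : ℝ, 0 < η → ∃ C : ℝ, ∃ k₀ : ℕ, ∀ m : ℕ, k₀ ≤ m → ∀ z ∈ box 4 (Ls m), η ≤ ‖a (βs m) • siteToE z‖ → |ker6 (βs m) (Ls m) p q z| ≤ C) → (∀ p q : Fin 4 × Fin 4, p.1 < p.2 → q.1 < q.2 → ∀ η : ℝ, 0 < η → ∀ τ : ℝ, 0 < τ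 → ∃ Λ : ℝ, ∃ k₀ : ℕ, ∀ m : ℕ, k₀ ≤ m → ∀ (k : Fin 4) (z : Fin 4 → ℤ) (n : ℕ), (∀ j : ℕ, j ≤ n → z + Pi.single k (j : ℤ) ∈ box 4 (Ls m) ∧ η ≤ ‖a (βs m) • siteToE (z + Pi.single k (j : ℤ))‖ ∧ τ ≤ |a (βs m) * (z k + j)|) → |ker6 (βs m) (Ls m) p q z - ker6 (βs m) (Ls m) p q (z + Pi.single k (n : ℤ))| ≤ Λ * (a (βs m) * n)) → ∃ (φ : ℕ → ℕ) (K : EuclideanSpace ℝ (Fin 4) → ℝ), StrictMono φ ∧ (∀ η ε : ℝ, 0 < η → 0 < ε → ∃ k₀ : ℕ, ∀ k : ℕ, k₀ ≤ k → ∀ z ∈ box 4 (Ls (φ k)), (∀ i : Fin 4, η ≤ |a (βs (φ k)) * (z i : ℝ)|) → ‖a (βs (φ k)) • siteToE z‖ ≤ η⁻¹ → |ker (βs (φ k)) (Ls (φ k)) z - K (a (βs (φ k)) • siteToE z)| ≤ ε) ∧ Measurable K ∧ ContinuousOn K {z | ∀ i : Fin 4, z i ≠ 0} ∧ (∀ η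 : ℝ, 0 < η → ∃ C : ℝ, ∀ z : EuclideanSpace ℝ (Fin 4), η ≤ ‖z‖ → |K z| ≤ C) ∧ (∀ z : EuclideanSpace ℝ (Fin 4), K (-z) = K z) ∧ (∀ z : EuclideanSpace ℝ (Fin 4), K (timeReflection 4 z) = K z) ∧ (∀ (w : SchwartzMap (EuclideanSpace ℝ (Fin 4)) ℝ) (t₀ T : ℝ), 0 < t₀ → tsupport (w : EuclideanSpace ℝ (Fin 4) → ℝ) ⊆ {y | t₀ ≤ y 0 ∧ y 0 ≤ T} → 0 ≤ ∫ x, ∫ y, (thetaTest 4 w) x * w y * K (y - x)) ∧ (∀ (w₁ w₂ : SchwartzMap (EuclideanSpace ℝ (Fin 4)) ℝ) (t₀ T : ℝ), 0 < t₀ → tsupport (w₁ : EuclideanSpace ℝ (Fin 4) → ℝ) ⊆ {y | t₀ ≤ -(y 0) ∧ -(y 0) ≤ T} → tsupport (w₂ : EuclideanSpace ℝ (Fin 4) → ℝ) ⊆ {y | t₀ ≤ y 0 ∧ y 0 ≤ T} → Filter.Tendsto (fun k => Q2 G r (βs (φ k)) (Ls (φ k)) (a (βs (φ k))) w₁ w₂)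 Filter.atTop (nhds (∫ x, ∫ y, w₁ x * w₂ y * K (y - x))))

/-- STUB 2 of `BlindDetector` (blind detector rigidity on `Ω`; L) — an obligation of LINE g11-1, believed true
(the landed `Cruxes.DetectorRigidity` chain with measurability threaded in place of continuity). -/
def BlindDetectorRigidity : Prop :=
  open MeasureTheory Literature.MathematicalPhysics.QuantumLattice in ∀ (K : EuclideanSpace ℝ (Fin 4) → ℝ) (h : ℝ → ℝ) (ta tb : ℝ) (v₀ : SchwartzMap (EuclideanSpace ℝ (Fin 4)) ℝ), Measurable K → ContinuousOn K {z | ∀ i : Fin 4, z i ≠ 0} → (∀ η : ℝ, 0 < η → ∃ C : ℝ, ∀ z : EuclideanSpace ℝ (Fin 4), η ≤ ‖z‖ → |K z| ≤ C) → (∀ z : EuclideanSpace ℝ (Fin 4), K (-z) = K z) → (∀ z : EuclideanSpace ℝ (Fin 4), K (timeReflection 4 z) = K z) → (∀ (w : SchwartzMap (EuclideanSpace ℝ (Fin 4)) ℝ) (t₀ T : ℝ), 0 < t₀ → tsupport (w : EuclideanSpace ℝ (Fin 4) → ℝ) ⊆ {y | t₀ ≤ y 0 ∧ y 0 ≤ T}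 → 0 ≤ ∫ x, ∫ y, (thetaTest 4 w) x * w y * K (y - x)) → 0 < ta → Continuous h → (∀ t, 0 ≤ h t) → tsupport h ⊆ Set.Icc ta tb → (∃ t, h t ≠ 0) → (∀ y, v₀ y = h (y 0) * Real.exp (-‖y‖ ^ 2)) → (∫ x, ∫ y, (thetaTest 4 v₀) x * v₀ y * K (y - x)) = 0 → ∀ z : EuclideanSpace ℝ (Fin 4), (∀ i : Fin 4, z i ≠ 0) → K z = 0

/-- COMPOSITION (kernel-checked): the two stubs imply the support item `BlindDetector`
(stmt-QuantumFields-24148) — by contradiction with the landed universal detector `v₀`. -/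
theorem blindDetector_of (hX : BlindSeqExtraction) (hR : BlindDetectorRigidity) :
    Summit.QuantumFields.YangMills.Theses.UniversalDetector.BlindDetector := by
  intro G _ _ _ _ hG r a ha hlim ker ker6 hBdd hLong hN
  obtain ⟨v₀, h, ta, tb, hta, hhc, hh0, hhsupp, hhne, hv₀, hsuppv, hsuppθ⟩ :=
    Summit.QuantumFields.YangMills.Theorems.universalDetector_detectorExists
  by_contra hcon
  push Not at hcon
  have hsupp0 : tsupport (v₀ : EuclideanSpace ℝ (Fin 4) → ℝ) ⊆ {y | 0 < y 0} := fun y hy =>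
    lt_of_lt_of_le hta (hsuppv hy).1
  choose βs hβs Ls hLs hQs using fun k : ℕ => hcon v₀ (1 / ((k : ℝ) + 1)) k k hsupp0 (by positivity)
  have hβs' : Filter.Tendsto βs Filter.atTop Filter.atTop :=
    Filter.tendsto_atTop_mono hβs tendsto_natCast_atTop_atTop
  have haL' : Filter.Tendsto (fun k => a (βs k) * (Ls k : ℝ)) Filter.atTop Filter.atTop :=
    Filter.tendsto_atTop_mono hLs tendsto_natCast_atTop_atTop
  -- the scheme-uniform ceilings hold eventually along the sequence (βs, Ls)
  have hev : ∀ β₅ Λ₅ : ℝ, ∃ k₀ : ℕ, ∀ m : ℕ, k₀ ≤ m → β₅ ≤ βs m ∧ Λ₅ ≤ a (βs m) * (Ls m : ℝ) := by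
    intro β₅ Λ₅
    obtain ⟨k₁, hk₁⟩ := Filter.eventually_atTop.1 (hβs'.eventually_ge_atTop β₅)
    obtain ⟨k₂, hk₂⟩ := Filter.eventually_atTop.1 (haL'.eventually_ge_atTop Λ₅)
    exact ⟨max k₁ k₂, fun m hm => ⟨hk₁ m (le_of_max_le_left hm), hk₂ m (le_of_max_le_right hm)⟩⟩
  have hBdd' : ∀ p q : Fin 4 × Fin 4, p.1 < p.2 → q.1 < q.2 → ∀ η : ℝ, 0 < η → ∃ C : ℝ, ∃ k₀ : ℕ, ∀ m : ℕ, k₀ ≤ m → ∀ z ∈ box 4 (Ls m), η ≤ ‖a (βs m) • siteToE z‖ → |ker6 (βs m) (Ls m) p q z| ≤ C := by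
    intro p q hp hq η hη
    obtain ⟨C, β₅, Λ₅, hC⟩ := hBdd p q hp hq η hη
    obtain ⟨k₀, hk₀⟩ := hev β₅ Λ₅
    exact ⟨C, k₀, fun m hm z hz hηz => hC (βs m) (hk₀ m hm).1 (Ls m) (hk₀ m hm).2 z hz hηz⟩
  have hLong' : ∀ p q : Fin 4 × Fin 4, p.1 < p.2 → q.1 < q.2 → ∀ η : ℝ, 0 < η → ∀ τ : ℝ, 0 < τ → ∃ Λ : ℝ, ∃ k₀ : ℕ, ∀ m : ℕ, k₀ ≤ m → ∀ (k : Fin 4) (z : Fin 4 → ℤ) (n : ℕ), (∀ j : ℕ, j ≤ n → z + Pi.single k (j : ℤ) ∈ box 4 (Ls m) ∧ η ≤ ‖a (βs m) • siteToE (z + Pi.single k (j : ℤ))‖ ∧ τ ≤ |a (βs m) * (z k + j)|) → |ker6 (βs m) (Ls m) p q z - ker6 (βs m) (Ls m) p q (z + Pi.single k (n : ℤ))| ≤ Λ * (a (βs m) * n) := by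
    intro p q hp hq η hη τ hτ
    obtain ⟨Λ, β₅, Λ₅, hΛ⟩ := hLong p q hp hq η hη τ hτ
    obtain ⟨k₀, hk₀⟩ := hev β₅ Λ₅
    exact ⟨Λ, k₀, fun m hm k z n hzn => hΛ (βs m) (hk₀ m hm).1 (Ls m) (hk₀ m hm).2 k z n hzn⟩
  -- blind extraction: a subsequential limit kernel K, controlled on Ω = {all coordinates ≠ 0} only
  obtain ⟨φ, K, hφ, hconv, hKm, hKc, hKb, hKe, hKθ, hRP, hQ2lim⟩ :=
    hX G hG r a ha hlim βs Ls hβs' haL' hBdd' hLong'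
  have hlimQ := hQ2lim _ v₀ ta tb hta hsuppθ hsuppv
  have hg0 : Filter.Tendsto (fun k => 1 / ((φ k : ℝ) + 1)) Filter.atTop (nhds 0) :=
    tendsto_one_div_add_atTop_nhds_zero_nat.comp hφ.tendsto_atTop
  have hIle := le_of_tendsto_of_tendsto hlimQ hg0 (Filter.Eventually.of_forall fun k => (hQs (φ k)).le)
  have hI0 := le_antisymm hIle (hRP v₀ ta tb hta hsuppv)
  -- blind rigidity: the universal detector kills K on Ω
  have hK0 : ∀ z : EuclideanSpace ℝ (Fin 4), (∀ i : Fin 4, z i ≠ 0) → K z = 0 :=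
    hR K h ta tb v₀ hKm hKc hKb hKe hKθ hRP hta hhc hh0 hhsupp hhne hv₀ hI0
  -- NONCONTACT_Ω along the extracted subsequence: contradiction
  obtain ⟨z, hz, hKz⟩ := hN (fun k => βs (φ k)) (fun k => Ls (φ k)) K (hβs'.comp hφ.tendsto_atTop)
    (haL'.comp hφ.tendsto_atTop) hconv
  exact hKz (hK0 z hz)

/-- STUB (deciding crux, stmt-QuantumFields-24146): EDGE ∧ NONCONTACT_Ω at one scheme — the route's `closes` binder
since rev 10; the stronger entries 24087 ⇒ 23999 ⇒ 23250 ⇒ 24146 are the landed chain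
`Theorems/UniversalDetectorSchemeEdgeBitOfEntries.lean`. -/
theorem stub_schemeEdgeBit : SchemeEdgeBit := by
  sorry

/-- STUB (residual crux, stmt-QuantumFields-24149): clause (ii) of `LowerBounds` at every EDGE ∧ NONCONTACT_Ω scheme. -/
theorem stub_skewAtEdgeScheme : SkewAtEdgeScheme := by
  sorry

/-- NO LONGER A STUB (rev 4): the blind sequential extraction was PROVED by ★ ym-spine-19353-p1 g26 — ✓p707587
`Theorems/UniversalDetectorBlindSeqExtraction.lean`, decl `Cruxes.UniversalDetectorBlindExtraction.blindSeqExtraction` (verbatim text; six landed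
helpers: mesh Arzelà–Ascoli with a gauge, orthant modulus, lattice extraction on orthant annuli, hyperplane cutoffs, blind Q2 template, lattice kernels). -/
theorem stub_blindSeqExtraction : BlindSeqExtraction :=
  Summit.QuantumFields.YangMills.Cruxes.UniversalDetectorBlindExtraction.blindSeqExtraction

/-- NO LONGER A STUB (rev 3): blind detector rigidity on `Ω` (stub 2 of item 24148) was PROVED by ym-line-sfw-p2-w4 g22 —
✓p705845 `Theorems/UniversalDetectorBlindRigidity.lean` (commit 1f1d45cdc986), decl
`Summit.QuantumFields.YangMills.Cruxes.BlindDetectorRigidity.blindDetectorRigidity`, typed against this file's text VERBATIM. -/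
theorem stub_blindDetectorRigidity : BlindDetectorRigidity :=
  Summit.QuantumFields.YangMills.Cruxes.BlindDetectorRigidity.blindDetectorRigidity

/-- COMPOSITION: the four stubs decide `NT` through the route's `closes` (rev 10) and the landed item proofs
`universalDetector_hankelCeiling` (24000), `universalDetector_hankelLongitudinal` (24001). -/
theorem NT_of : SchemeEdgeBit → SkewAtEdgeScheme → BlindSeqExtraction → BlindDetectorRigidity →
    Summit.QuantumFields.YangMills.Theses.BalabanLadder.NT :=
  fun hB h5 hX hR =>
    Summit.QuantumFields.YangMills.Theses.UniversalDetector.closes hB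
      Summit.QuantumFields.YangMills.Cruxes.UniversalDetectorHankel.universalDetector_hankelCeiling
      Summit.QuantumFields.YangMills.Cruxes.UniversalDetectorHankel.universalDetector_hankelLongitudinal
      (blindDetector_of hX hR) h5

/-- The same composition entered from the STRONGER g10-3 entry `SchemeCurvatureLaws` (24087), through the landed chain
`schemeEdgeBit_of_schemeCurvatureLaws` (CurvatureEdgeGlue ✓ · HankelTightGlue ✓ · BitOfPlaneTight ✓24147). -/
theorem NT_of_schemeCurvatureLaws : SchemeCurvatureLaws → SkewAtEdgeScheme → BlindSeqExtraction →
    BlindDetectorRigidity → Summit.QuantumFields.YangMills.Theses.BalabanLadder.NT :=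
  fun hK h5 hX hR =>
    -- the landed chain, composed inline (= `Theorems.UniversalDetectorEntries.schemeEdgeBit_of_schemeCurvatureLaws`)
    NT_of
      (Summit.QuantumFields.YangMills.Theorems.universalDetector_bitOfPlaneTight_proof
        (Summit.QuantumFields.YangMills.Theorems.hankelTightGlue_proof
          (Summit.QuantumFields.YangMills.Cruxes.UniversalDetectorHankel.universalDetector_curvatureEdgeGlue hK
            Summit.QuantumFields.YangMills.Cruxes.UniversalDetectorHankel.universalDetector_hankelCeiling)
          Summit.QuantumFields.YangMills.Cruxes.UniversalDetectorHankel.universalDetector_hankelCeiling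
          Summit.QuantumFields.YangMills.Cruxes.UniversalDetectorHankel.universalDetector_hankelLongitudinal))
      h5 hX hR

/-- `NT` from the stubs (sorries exactly the two crux stubs `stub_schemeEdgeBit`, `stub_skewAtEdgeScheme`). -/
theorem NT_of_stubs : Summit.QuantumFields.YangMills.Theses.BalabanLadder.NT :=
  NT_of stub_schemeEdgeBit stub_skewAtEdgeScheme stub_blindSeqExtraction stub_blindDetectorRigidity

end Summit.QuantumFields.YangMills.Cruxes.NT.BlindDetector
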